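import Summits.ResolutionOfSingularities.ResolutionOfSingularities.Theorems.FrobeniusClosingSteerArithTransportFineResidue
import Summits.ResolutionOfSingularities.ResolutionOfSingularities.Theorems.FrobeniusClosingSteerArithReductionOneAxis
import Summits.ResolutionOfSingularities.ResolutionOfSingularities.Theorems.FrobeniusClosingSteerVisitLawDelta
import Summits.ResolutionOfSingularities.ResolutionOfSingularities.Theorems.FrobeniusClosingSteerQuadraticTransformResiduallyFinite
import HarnessLib

/-!
# K-β0(b) fine word (F-AB) `ArithTransportFine.BinaryBConeAfterATwoN` — the ON-LINE CASE PROVED: at a visit pair leaving an A-stage with an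
  `e = 2` binary cone `Ψ(m₁, m₂)` whose pair lies ON THE AXIS of the exceptional parameter (`v m₁, v m₂ < v u`) and landing with cleaned order
  `d + 1`, the member at `j′` has the FINE-CLASS B-shape along `u` (res-L0-w41-plan-1 RULINGs 318 (d) / 322 (ii); def-free)

OURS (campaign `res-hironaka`, rung L ★L-G4, slot W4.1 · crux `Steer` (stmt-ResolutionOfSingularities-16345) · K-β0(b) = tree induction
`ArithTransportFine.arithTransport_of_six_fine_words` p578229 ✓ modulo the six fine words p577210 ✓). Candidates, not facts; nothing here is a statement
of H. Hironakaʼs manuscript [claim: Hironaka2017, status: under-review]; AI-written, AI review is weaker than expert review.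

`binaryBConeE2At_afterA_online` = (F-AB) with the cone data `(g, m₁, m₂, Ψ)` of `ArithTransport.BinaryConeE2At R s 2 d j` EXPLICIT and the extra
ON-LINE hypothesis `O.valuation m₁ < O.valuation u ∧ O.valuation m₂ < O.valuation u` (the landing point — the centre of `O` on `R (j+1)` — lies on
the axis `V(m₁/u, m₂/u)` of the cone). Assembly of tree kernels, no new mathematics:
(1) cleaned order `d` at `j` from the cone (`ArithTransport.hasCleanedOrderAt_of_cone`, p573155) ⇒ the visit law `VisitLawDelta.visitLaw₂_of_run`:
`R j′ = R (j+1)`, `s_{j′}·u^((d−1)/2)·W = s_j − G`; (2) res-D-pv-003ʼs transport `OddBranchParity.isRsopPart_excParam_strictTransform₂` — `(u, m₁/u, m₂/u)`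
is an r.s.o.p.-part of `R j′` — and division `OddBranchParity.div_pow_mem_and_sub_eval_mem` — `F/u^d ≡ Ψ′(m₁/u, m₂/u) (mod u)` for `F := s_j² − g²`;
(3) the law algebra `ArithReductionLegality.sq_eq_of_law_odd_unit` + normality `SwitchPlane.mem_of_sq_mem_transform` ⇒ the RAW presentation
`s_{j′}² = T² + u·Ψ′_W(m/u) + u²·θ` (`Ψ′_W := C(W⁻²)·map Ψ`, `θ ∈ R j′` arbitrary); (4) the `e = 2` clause at `j′`: `e2_map_of_isLocalHom` (odd `d`,
characteristic `2`; the inclusion `R j → R j′` is local by domination) and `e2_C_mul`; (5) the stage-`j′` kernel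
`binaryBConeE2At_of_presentation_of_hasCleanedOrderAt` (p580900) re-cleans with the landing hypothesis `HasCleanedOrderAt R s 2 j′ (d + 1)`.
⇒ **(F-AB) = CLOSED-MODULO the OFF-LINE EXCLUSION** «at such a visit `v m₁ < v u` and `v m₂ < v u`» (equivalently: no `mᵢ/u` is a unit of
`R j′`), which is res-D-pv-053ʼs NEAR-A reading (`NearA.parityBound` + `…ArithNearACone`: an off-line landing with cleaned order `d + 1`
makes the landing direction a root of multiplicity `≥ d` of `Ψ̄`, against `e = 2`; the unit sub-case is `not_hasCleanedOrderAt_of_isUnit`, p580900).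
[cite: Matsumura1987, Thm. 14.2] [cite: NovacoskiSpivakovsky2014, Def. 2.11] [folklore]
-/

noncomputable section

-- `Summit.<S>.<S>.…` duplicates the summit name by design (single-problem summit).
set_option linter.dupNamespace false

open IsLocalRing MvPolynomial
open Literature.AlgebraicGeometry.Resolution
open Summit.ResolutionOfSingularities.ResolutionOfSingularities.Theorems.SwitchingDichotomy.Words

namespace Summit.ResolutionOfSingularities.ResolutionOfSingularities.Theorems.SwitchingDichotomy.ArithTransportFine

section AfterA

variable {K : Type} [Field K] [CharP K 2] {O : ValuationSubring K} {R : ℕ → Subring K} {P : (i : ℕ) → Ideal (R i)}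
  {t : K} {s : ℕ → K}

/-- **(F-AB) on-line.** Steered run at `p = 2` in characteristic `2`, `R 0` dominated by `O`, regular members; a visit pair `(j, j′)`, an
exceptional parameter `u` of the step `j` with its strip clause and N4ʼs height-one clause at `j′`; at `j` an `e = 2` binary cone of ODD degree
`d ≥ 3`: `s_j² − g² − Ψ(m₁, m₂) ∈ 𝔪^(d+1)`, `(m₁, m₂)` an r.s.o.p.-part, `Ψ̄` not `c·ℓ^d`; ON-LINE: `v m₁ < v u`, `v m₂ < v u`; landing with cleaned
order `d + 1` at `j′`. Then `BinaryBConeE2At R s 2 u d j′` (fine class along `u`, pair `(m₁/u, m₂/u)`, form `W⁻²·Ψ`). See the module docstring for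
the five tree kernels assembled. [cite: Matsumura1987, Thm. 14.2] [cite: NovacoskiSpivakovsky2014, Def. 2.11] [folklore] -/
theorem binaryBConeE2At_afterA_online (hrun : IsSteeredRun O R P t 2 s) (hR0 : SubringDominates (R 0) O.toSubring)
    (hreg : ∀ i, IsRegularLocalRing (R i)) {j j' : ℕ} (hvisit : IsVisitPair R P j j') {u : K}
    (hu : IsExcParamAlong O (R j) (P j) u)
    (Hγ : ∀ l, j < l → l < j' → ∃ hu : u ∈ R l, P l = Ideal.span {(⟨u, hu⟩ : R l)})
    (h1 : ∀ (hs' : s j' ^ 2 ∈ R j') (Q : Ideal (R j')) [Q.IsPrime], Q.height = 1 →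
      ¬ SigmaTopLegality.IsSingPrime (R j') 2 ⟨s j' ^ 2, hs'⟩ Q)
    {d : ℕ} (hd : Odd d) (h3 : 3 ≤ d)
    [hlocj : IsLocalRing (R j)] (hsj : s j ^ 2 ∈ R j) {g m₁ m₂ : R j} {Ψ : MvPolynomial (Fin 2) (R j)}
    (hm : IsRsopPart ![m₁, m₂]) (hΨ : Ψ.IsHomogeneous d)
    (hcong : (⟨s j ^ 2, hsj⟩ : R j) - g ^ 2 - MvPolynomial.eval ![m₁, m₂] Ψ ∈ maximalIdeal (R j) ^ (d + 1))
    (hE : ¬ ∃ a b c : ResidueField (R j), MvPolynomial.map (residue (R j)) Ψ = C c * (C a * X 0 + C b * X 1) ^ d)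
    (hon₁ : O.valuation (m₁ : K) < O.valuation u) (hon₂ : O.valuation (m₂ : K) < O.valuation u)
    (hclj' : HasCleanedOrderAt R s 2 j' (d + 1)) :
    BinaryBConeE2At R s 2 u d j' := by
  classical
  have hdom : ∀ i, SubringDominates (R i) O.toSubring := fun i => VisitLawPointStep.subringDominates_of_run hrun hR0 i
  have hbl : ∀ i, IsLocalBlowupAlong O (R i) (P i) (R (i + 1)) := fun i => (hrun.2 i).2.2.2.1
  -- ### the point step `j` and its exceptional parameter
  obtain ⟨_, hPj⟩ := hvisit.2.1
  obtain ⟨⟨huR, huP⟩, hu0, humax⟩ := id hu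
  have hum : (⟨u, huR⟩ : R j) ∈ maximalIdeal (R j) := by rw [← hPj]; exact huP
  have humax' : ∀ y : R j, y ∈ maximalIdeal (R j) → O.valuation (y : K) ≤ O.valuation u :=
    fun y hy => humax y (by rw [hPj]; exact hy)
  have hbl𝔪 : IsLocalBlowupAlong O (R j) (maximalIdeal (R j)) (R (j + 1)) := by rw [← hPj]; exact hbl j
  haveI hregj : IsRegularLocalRing (R j) := hreg j
  -- ### cleaned order `d` at `j` (from the cone) and the visit law
  have hclj : HasCleanedOrderAt R s 2 j d :=
    ArithTransport.hasCleanedOrderAt_of_cone (hreg j) hd hsj hm hΨ hcong (ArithTransport.map_residue_ne_zero_of_e2 hE)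
  obtain ⟨⟨hRj', G, W, hG, hW, hWinv, hW0, hlaw⟩, -, -⟩ :=
    VisitLawDelta.visitLaw₂_of_run hrun hR0 hvisit hu Hγ hreg h1 (by omega : 2 ≤ d) hclj
  have hbl' : IsLocalBlowupAlong O (R j) (maximalIdeal (R j)) (R j') := hRj' ▸ hbl𝔪
  have hle : R j ≤ R j' := hbl'.isLocalBlowup.le
  haveI hregj' : IsRegularLocalRing (R j') := hreg j'
  haveI hlocj' : IsLocalRing (R j') := (hrun.2 j').1
  have hsj' : s j' ^ 2 ∈ R j' := VisitLawPointStep.pow_mem_of_run hrun j'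
  -- ### (ON) the transported r.s.o.p.-part `(u, m₁/u, m₂/u)` of `R j′`
  obtain ⟨hu', hm₁', hm₂', hrs⟩ :=
    OddBranchParity.isRsopPart_excParam_strictTransform₂ (hdom j) hbl' huR hum hu0 humax' hm hon₁ hon₂
  -- ### (T) division: `F/u^d ≡ Ψ′(m₁/u, m₂/u) (mod u)` for `F := s_j² − g²`
  set F : R j := ⟨s j ^ 2, hsj⟩ - g ^ 2 with hF
  have hFcong : F - MvPolynomial.eval ![m₁, m₂] Ψ ∈ maximalIdeal (R j) ^ (d + 1) := hcong
  obtain ⟨hGmem, h₁, h₂, hdiff⟩ := OddBranchParity.div_pow_mem_and_sub_eval_mem hbl' huR hum hu0 humax' Ψ hΨ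
    (hm.mem_maximalIdeal 0) (hm.mem_maximalIdeal 1) hFcong
  set Ψ' : MvPolynomial (Fin 2) (R j') := MvPolynomial.map (Subring.inclusion hle) Ψ with hΨ'
  set uR : R j' := ⟨u, hle huR⟩ with huRdef
  set n₁ : R j' := ⟨(m₁ : K) / u, h₁⟩ with hn₁
  set n₂ : R j' := ⟨(m₂ : K) / u, h₂⟩ with hn₂
  have hdiff' : (⟨(F : K) / u ^ d, hGmem⟩ : R j') - MvPolynomial.eval ![n₁, n₂] Ψ' ∈ Ideal.span {uR} := hdiff
  obtain ⟨θ, hθ⟩ := Ideal.mem_span_singleton'.mp hdiff'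
  have hθK : (θ : K) * u = (F : K) / u ^ d - ((MvPolynomial.eval ![n₁, n₂] Ψ' : R j') : K) :=
    congrArg Subtype.val hθ
  -- ### the law algebra and the square part by normality
  obtain ⟨k, rfl⟩ := hd
  have hdiv : (2 * k + 1) / 2 = k := by omega
  rw [hdiv] at hlaw
  have hum0 : u ^ k ≠ 0 := pow_ne_zero _ hu0
  have hFK : (F : K) = s j ^ 2 - ((g : R j) : K) ^ 2 := by simp [hF]
  have hsq : s j' ^ 2 = u * (W⁻¹ ^ 2 * (F : K) / u ^ (2 * k + 1)) + (W⁻¹ * (((g : R j) : K) - G) / u ^ k) ^ 2 := by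
    rw [hFK, ← mul_div_assoc]
    have h := ArithReductionLegality.sq_eq_of_law_odd_unit (g := ((g : R j) : K)) hu0 hW0 hlaw
    rw [← mul_div_assoc] at h
    exact h
  have hgR : W⁻¹ * (((g : R j) : K) - G) ∈ R j' := (R j').mul_mem hWinv ((R j').sub_mem (hle g.2) hG)
  have humR : u ^ k ∈ R j' := (R j').pow_mem (hle huR) k
  have hEK : u * (W⁻¹ ^ 2 * (F : K) / u ^ (2 * k + 1)) =
      u * (W⁻¹ ^ 2 * ((MvPolynomial.eval ![n₁, n₂] Ψ' : R j') : K)) + u ^ 2 * (W⁻¹ ^ 2 * (θ : K)) := by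
    linear_combination (-(u * W⁻¹ ^ 2)) * hθK
  have hT1 : u * (W⁻¹ ^ 2 * ((MvPolynomial.eval ![n₁, n₂] Ψ' : R j') : K)) + u ^ 2 * (W⁻¹ ^ 2 * (θ : K)) ∈ R j' :=
    (R j').add_mem ((R j').mul_mem (hle huR) ((R j').mul_mem ((R j').pow_mem hWinv 2) (MvPolynomial.eval _ Ψ').2))
      ((R j').mul_mem ((R j').pow_mem (hle huR) 2) ((R j').mul_mem ((R j').pow_mem hWinv 2) θ.2))
  have hhsq : (W⁻¹ * (((g : R j) : K) - G) / u ^ k) ^ 2 ∈ R j' := by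
    have e : (W⁻¹ * (((g : R j) : K) - G) / u ^ k) ^ 2 = s j' ^ 2 - u * (W⁻¹ ^ 2 * (F : K) / u ^ (2 * k + 1)) := by
      rw [hsq]; ring
    rw [e, hEK]
    exact (R j').sub_mem hsj' hT1
  have hhR : W⁻¹ * (((g : R j) : K) - G) / u ^ k ∈ R j' := SwitchPlane.mem_of_sq_mem_transform hgR humR hum0 hhsq
  -- ### the raw presentation at `j′`
  set w : R j' := ⟨W⁻¹, hWinv⟩ ^ 2 with hw
  have hwu : IsUnit w := by
    refine (IsUnit.of_mul_eq_one (a := (⟨W⁻¹, hWinv⟩ : R j')) ⟨W, hW⟩ (Subtype.ext ?_)).pow 2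
    change W⁻¹ * W = 1
    exact inv_mul_cancel₀ hW0
  have hΨW : (C w * Ψ').IsHomogeneous (2 * k + 1) := by
    have h := (isHomogeneous_C (Fin 2) w).mul (hΨ.map (Subring.inclusion hle))
    rwa [zero_add] at h
  have hevW : MvPolynomial.eval ![n₁, n₂] (C w * Ψ') = w * MvPolynomial.eval ![n₁, n₂] Ψ' := by
    rw [_root_.map_mul, eval_C]
  have hf : (⟨s j' ^ 2, hsj'⟩ : R j') = ⟨_, hhR⟩ ^ 2 + uR * MvPolynomial.eval ![n₁, n₂] (C w * Ψ') + uR ^ 2 * (w * θ) := by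
    apply Subtype.ext
    rw [hevW]
    simp only [Subring.coe_add, Subring.coe_mul, SubmonoidClass.mk_pow, hw, huRdef]
    rw [hsq, hEK]
    ring
  -- ### the `e = 2` clause at `j′` (odd degree, characteristic two; the inclusion is local by domination)
  have hdomjj' : SubringDominates (R j) (R j') := (hdom j).of_le_of_le hle (hdom j').1
  haveI := EtaleLift.isLocalHom_inclusion_of_subringDominates hdomjj'
  have h2κ : (2 : ResidueField (R j')) = 0 := by
    rw [← map_ofNat (residue (R j')) 2, CharTwo.two_eq_zero, map_zero]
  have hdκ : ((2 * k + 1 : ℕ) : ResidueField (R j')) ≠ 0 := by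
    push_cast
    rw [h2κ, zero_mul, zero_add]
    exact one_ne_zero
  have hE' : ¬ ∃ a b c : ResidueField (R j'), MvPolynomial.map (residue (R j')) Ψ' = C c * (C a * X 0 + C b * X 1) ^ (2 * k + 1) :=
    e2_map_of_isLocalHom (Subring.inclusion hle) hdκ hE
  have hEW := e2_C_mul hwu hE'
  -- ### re-clean at `j′`
  exact binaryBConeE2At_of_presentation_of_hasCleanedOrderAt (hreg j') ⟨k, rfl⟩ (hle huR) hsj' hrs hΨW hf hclj' hEW

end AfterA

end Summit.ResolutionOfSingularities.ResolutionOfSingularities.Theorems.SwitchingDichotomy.ArithTransportFine
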